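import Summits.Ventures.PercRepro.LemmaBPlusK5Def

/-!
# Faces of `K₅`: kernel slices 52 … 53 (part N)

Each theorem is one `decide +kernel` at default heartbeats (≈ 55 s: the 1024-row table of the marking
plus ≤ 22 000 face points in sub-mask loops); generated by `tools/gen_k5.py`.
-/

namespace PercRepro

namespace Examples

open MultiGraph

/-- Slice 52: the join `u = 1023` (all edges), meets `v ∈ [164, 549)` (21998 face points). -/
theorem k5_slice_52 : k5.FacesSRangeV ![0, 1, 2, 3] 1023 164 549 := by decide +kernel

/-- Slice 53: the join `u = 1023` (all edges), meets `v ∈ [549, 1024)` (15091 face points). -/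
theorem k5_slice_53 : k5.FacesSRangeV ![0, 1, 2, 3] 1023 549 1024 := by decide +kernel

end Examples

end PercRepro
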